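import Summits.Ventures.AbcSig.Rows.Bridge
import Summits.Ventures.AbcSig.Rows.C2aL269A3
import Summits.Ventures.AbcSig.Rows.C2aL269A3AB

/-!
# Venture AbcSig — CELL `C2aL269A3`: the census statement `Rows.C2aCellRed 269 (fun a => a = 3) {11, 37}` from the two row theorems

HONEST FRAMING. COMPUTATION cell `pub-abcsig`; CONDITIONAL theorem; no claim on ABC or any summit. Hypotheses exactly as
in `Rows/C2aL269A3.lean` and `Rows/C2aL269A3AB.lean`: `BS04Package` (CITED), `DataComplete …` (COMPUTED level files), and the
rows' per-orbit exclusions for BOTH family predicates (`famB`, `famAB`) as universally quantified hypotheses (CITED: the census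
row's certificates). Conclusion = p1's census predicate (`Rows/Statements.lean`), all four coprime coefficient
distributions `A·B = 2^a·269^m`, reduced exponents `a < n`, `m < n` (RULING H1). GENERATED by p-lean gen/make_rows.py
(after plean/make_cell_bridges.py).
-/

namespace Summit.Ventures.AbcSig

/-- Cell `C2aL269A3`: `Rows.C2aCellRed 269 (fun a => a = 3) {11, 37}` under the rows' hypotheses. -/
theorem cell_C2aL269A3 (M : NewformModel) (hP : M.BS04Package)
    (hD538 : M.DataComplete 538 level538Orbits)
    (hD8608 : M.DataComplete 8608 level8608Orbits)
    (hX_orbit_538_5 : ∀ n m : ℕ, n ∈ ([7, 13] : List ℕ) → M.Excludes 538 orbit_538_5 (famB (2 ^ 3 * 269 ^ m) n (fun _ _ => True)))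
    (hX_orbit_538_5' : ∀ n m : ℕ, n ∈ ([7, 13] : List ℕ) → M.Excludes 538 orbit_538_5 (famAB (269 ^ m) (2 ^ 3) n (fun _ _ => True)))
    (hX_orbit_8608_8 : ∀ n m : ℕ, n ∈ ([61] : List ℕ) → M.Excludes 8608 orbit_8608_8 (famB (2 ^ 3 * 269 ^ m) n (fun _ _ => True)))
    (hX_orbit_8608_8' : ∀ n m : ℕ, n ∈ ([61] : List ℕ) → M.Excludes 8608 orbit_8608_8 (famAB (269 ^ m) (2 ^ 3) n (fun _ _ => True))) :
    Rows.C2aCellRed 269 (fun a => a = 3) {11, 37} :=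
  C2aCellRed_of_rows 269 (by norm_num) (by norm_num) _ _
    (fun n hn h11 hnℓ hR a m (ha : a = 3) han hm hmn x y z h1 h2 => by
      subst ha
      exact
 row_C2aL269A3 M hP hD538 hD8608 n hn h11 hnℓ (by simpa using hR) m hm hmn (hX_orbit_538_5 n m) (hX_orbit_8608_8 n m) x y z h1 h2)
    (fun n hn h11 hnℓ hR a m (ha : a = 3) han hm hmn x y z h1 h2 => by
      subst ha
      exact
 row_C2aL269A3AB M hP hD538 hD8608 n hn h11 hnℓ (by simpa using hR) m hm hmn (hX_orbit_538_5' n m) (hX_orbit_8608_8' n m) x y z h1 h2)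

end Summit.Ventures.AbcSig
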